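import Mathlib
import Literature.NumberTheory.LFunctions.Zhang2022.Section16BU033NonCoprime
import Literature.NumberTheory.LFunctions.Zhang2022.Section16BInnerSum1614
import Literature.NumberTheory.LFunctions.Zhang2022.Section16BU035Lw
import Literature.NumberTheory.LFunctions.Zhang2022.Section16BU034L
import Literature.NumberTheory.LFunctions.Zhang2022.TypedSection16BE
import HarnessLib

/-!
# Zhang (2022) §16 p. 94, u037 REPAIRED in the local reading: `Step16_u037RLE e1pp c′` from
# Lemma 15.1-χ (E-reading) and the rough multiplicative majorant (R)

Topic `Literature/NumberTheory/LFunctions/Zhang2022` (Landau–Siegel audit tree; verdict-neutral).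
Y. Zhang, *Discrete mean estimates and the Landau–Siegel zero*, arXiv:2211.02515v1 (2022)
[Zhang2022LandauSiegel] — **an unrefereed manuscript under adjudication**; this file proves an EDGE
between typed claims about the manuscript's own objects and asserts nothing about its Theorems 1–2.
ZHANG-L WP16 (seat zl-w16-p8), Block A of leaf h16_16 (binder `Eq16_16R2E`), node
`Typed.Section16B.Step16_u037RLE e1pp c′` (`TypedSection16BE`; printed instance `e1pp = e1ppj` is
`Step16_u037RL`, GAP row G-L4t5-1, local reading F16B-1): for each `n₁ ∈ 𝔫(𝔮)`, `n₁ < T`,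
`Σ_{(n,𝔮)=1} b₁(n₁n)ϖ₂ⱼ^loc(n)/n = 𝔢ⱼ[e1pp]·Σ_{m₁∣n₁}χ(m₁)τ₂(m₁) + O(τ₃(n₁)𝓛⁻⁷ + D^{−c})`
[Z22 §16 pp. 93–94, tex L4605–L4633: u032 → u033 → u035 → (16.14) → "innermost sum `= 1 + O(𝓛⁻⁷)`" → u037].

`step16_u037RLE_of : Lemma151ChiRE e1pp c′ → (R) → Step16_u037RLE e1pp c′` assembles the lane's pieces:
the EXACT re-indexing `u033_reindex` (+ `step16_u032_holds`), the split `u033_split`, the non-coprime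
correction `u033_noncoprime_le` (`≪ τ₂(m₁)𝓛⁴⁴/D⁴` per outer pair, `𝓛⁵¹ ≤ D⁴`), the innermost sum
`inline16_innerSum1614L_of_roughMajorant` (`= 1 + O(𝓛⁻⁷)`, from (R)), and the `m`-sum
`step16_u035LwE_of_lemma151ChiRE` (`= 𝔢ⱼχ(m₁)τ₂(m₁) + O((α𝓛+𝓛⁻⁷)τ₂(m₁))`); summing over the `τ₂`-many…
precisely over the divisor pairs `(l₁,m₁)` of `n₁` produces the `τ₃(n₁) = Σ_{m₁∣n₁}τ₂(m₁)` currency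
(`c = 1`; the `D^{−c}` slot is not needed). Corollary `step16_u037RL_of` = the printed instance.

## References
* Y. Zhang, arXiv:2211.02515v1 (2022), §16 pp. 93–94 (u032–u037, (16.14)), tex L4605–L4633.
  [cite: Zhang2022LandauSiegel, §16 p. 94 (u037)]
-/

noncomputable section

open Complex Real Finset Filter Topology

namespace Literature.NumberTheory.LFunctions.Zhang2022.Typed.Section16B

open Literature.NumberTheory.LFunctions.Zhang2022
open Literature.NumberTheory.LFunctions.Zhang2022.Skeleton
open Literature.NumberTheory.LFunctions.Zhang2022.Typed.Section16A

variable (c' : ℝ)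

/-- Any real threshold on `𝓛 = log D` holds for all large `D`. [cite: Zhang2022LandauSiegel, §2 (2.1)] -/
private theorem exists_forall_le_ell_37 (M : ℝ) : ∃ D₀ : ℕ, ∀ D : ℕ, D₀ ≤ D → M ≤ ell D := by
  refine ⟨⌈Real.exp M⌉₊ + 1, fun D hD => ?_⟩
  have hD1 : (⌈Real.exp M⌉₊ : ℝ) + 1 ≤ D := by exact_mod_cast hD
  have hD0 : (0 : ℝ) < D := by linarith [Nat.le_ceil (Real.exp M), Real.exp_pos M]
  rw [ell, Real.le_log_iff_exp_le hD0]
  linarith [Nat.le_ceil (Real.exp M)]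

/-- `𝔫(d)` is divisor-closed. [cite: Zhang2022LandauSiegel, §7 p. 13 (`𝔫(d)`)] -/
private theorem mem_nset_of_dvd' {d n m : ℕ} (hn : n ∈ nset d) (hm : m ∣ n) : m ∈ nset d :=
  ⟨Nat.pos_of_dvd_of_pos hm hn.1, fun q hq hqm => hn.2 q hq (hqm.trans hm)⟩

/-- `𝓛⁵¹ ≤ D⁴` once `𝓛 ≥ 52!` (`𝓛⁵²/52! ≤ e^{𝓛} = D ≤ D⁴`). [folklore] -/
private theorem ell_pow_51_le {D : ℕ} (hD : 1 ≤ D) (hℓ : (Nat.factorial 52 : ℝ) ≤ ell D) :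
    ell D ^ 51 ≤ (D : ℝ) ^ 4 := by
  have hD0 : (0 : ℝ) < D := by exact_mod_cast hD
  have hD1 : (1 : ℝ) ≤ D := by exact_mod_cast hD
  have hℓ0 : 0 ≤ ell D := Real.log_nonneg hD1
  have h := Real.pow_div_factorial_le_exp (ell D) hℓ0 52
  rw [ell, Real.exp_log hD0, ← ell] at h
  have hfac : (0 : ℝ) < Nat.factorial 52 := by positivity
  rw [div_le_iff₀ hfac] at h
  have hD4 : (D : ℝ) ≤ (D : ℝ) ^ 4 := le_self_pow₀ hD1 (by norm_num)
  refine le_trans ?_ hD4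
  have h51 : 0 ≤ ell D ^ 51 := by positivity
  nlinarith [mul_le_mul_of_nonneg_left hℓ h51]

open scoped Classical in
/-- **u037 repaired, local reading, generic in `e″ = e1pp`** — EDGE
`Lemma151ChiRE e1pp c′ → (R) → Typed.Section16B.Step16_u037RLE e1pp c′` ((R) = the rough multiplicative
majorant, Sketch5 S8 text, spelled inline): for all large `D` under (A), `j ∈ {1,2}`, `n₁ ∈ 𝔫(𝔮)`, `n₁ < T`,
`‖Σ_{(n,𝔮)=1,n<P} b₁(n₁n)ϖ₂ⱼ^loc(n)/n − 𝔢ⱼ[e1pp]Σ_{m₁∣n₁}χ(m₁)τ₂(m₁)‖ ≤ C(τ₃(n₁)𝓛⁻⁷ + D⁻¹)`.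
[cite: Zhang2022LandauSiegel, §16 p. 94 (u037)] -/
theorem step16_u037RLE_of (e1pp : ℕ → ℂ) (h151 : Lemma151ChiRE e1pp c')
    (hR : ∃ C₀ : ℝ, 0 ≤ C₀ ∧ ForAllLarge fun D _ χ => AssumptionA D χ → ∀ j ∈ ({1, 2} : Finset ℕ),
      ∀ q r : ℕ, q.Prime → ¬ q ∣ frakq D → 1 ≤ r → ((q ^ r : ℕ) : ℝ) < bigT D ^ 5 →
        ‖varpi2loc c' χ j (q ^ r)‖ * tau3R (q ^ r) ≤
          if r = 1 then 3 * ‖nu χ q‖ + C₀ * (alpha D * Real.log q + (q : ℝ)⁻¹)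
            else C₀ * (3 / 2 : ℝ) ^ r) :
    Step16_u037RLE e1pp c' := by
  -- inputs
  obtain ⟨C_L, D_L, hL⟩ := inline16_innerSum1614L_of_roughMajorant c' hR
  obtain ⟨C_M, D_M, hM⟩ := step16_u035LwE_of_lemma151ChiRE c' e1pp h151
  obtain ⟨D₃₂, h32⟩ := step16_u032_holds c'
  obtain ⟨D_ϖ, hϖ⟩ := norm_varpi2loc_le c'
  -- constants
  set Cb : ℝ := (1 + ‖iota2‖) * (‖iota3‖ + ‖iota4‖) with hCb
  have hCb0 : 0 ≤ Cb := by positivity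
  set Km : ℝ := MeanSquareMajorant.majorantConst (2 ^ 2) (2 * 2) with hKm
  set E₀ : ℝ := 124416 * Km ^ 2 with hE₀
  have hE₀0 : 0 ≤ E₀ := by positivity
  set Ef : ℝ := ‖frakeE e1pp 1‖ + ‖frakeE e1pp 2‖ with hEf
  have hEf0 : 0 ≤ Ef := by positivity
  set C_L' : ℝ := max C_L 0 with hC_L'
  set C_M' : ℝ := max C_M 0 with hC_M'
  have hC_L'0 : 0 ≤ C_L' := le_max_right _ _
  have hC_M'0 : 0 ≤ C_M' := le_max_right _ _
  set Cmain : ℝ := C_L' * Ef + 2 * C_L' * C_M' + 2 * C_M' with hCmain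
  have hCmain0 : 0 ≤ Cmain := by positivity
  refine ⟨1, one_pos, Cmain + Cb * E₀, ?_⟩
  obtain ⟨D₁, hD₁⟩ := exists_forall_le_ell_37 (max ((4 : ℝ) ^ 10) (Nat.factorial 52))
  refine ⟨max (max D_L D_M) (max (max D₃₂ D_ϖ) D₁), fun D _ χ hD hq hp hA j hj n₁ hn₁ hn₁T => ?_⟩
  have hD_L : D_L ≤ D := le_trans (le_trans (le_max_left _ _) (le_max_left _ _)) hD
  have hD_M : D_M ≤ D := le_trans (le_trans (le_max_right _ _) (le_max_left _ _)) hD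
  have hD₃₂ : D₃₂ ≤ D :=
    le_trans (le_trans (le_trans (le_max_left _ _) (le_max_left _ _)) (le_max_right _ _)) hD
  have hD_ϖ : D_ϖ ≤ D :=
    le_trans (le_trans (le_trans (le_max_right _ _) (le_max_left _ _)) (le_max_right _ _)) hD
  have hD₁' : D₁ ≤ D := le_trans (le_trans (le_max_right _ _) (le_max_right _ _)) hD
  have hℓ : (4 : ℝ) ^ 10 ≤ ell D := le_trans (le_max_left _ _) (hD₁ D hD₁')
  have hℓ52 : (Nat.factorial 52 : ℝ) ≤ ell D := le_trans (le_max_right _ _) (hD₁ D hD₁')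
  have h410 : (4 : ℝ) ^ 10 = 1048576 := by norm_num
  have hℓ1 : 1 ≤ ell D := by linarith
  have hℓ0 : 0 < ell D := by linarith
  have hℓ10 : 10 ≤ ell D := by linarith
  have hℓ2 : 2 ≤ Real.log D := by rw [← ell]; linarith
  have hD1 : 1 ≤ D := by
    by_contra h
    have : D = 0 := by omega
    subst this; simp [ell] at hℓ0
  have hDpos : (0 : ℝ) < D := by exact_mod_cast (show 0 < D by omega)
  have hn₁0 : n₁ ≠ 0 := hn₁.1.ne'
  -- the eventual inputs at this `D`
  have eL := hL D χ hD_L hq hp hA j hj n₁ hn₁ hn₁T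
  have eM := hM D χ hD_M hq hp hA j hj
  have e32 : ∀ n : ℕ, 1 ≤ n → Nat.Coprime n (frakq D) →
      b1coef c' χ (n₁ * n) = ∑ x ∈ n₁.divisorsAntidiagonal, ∑ y ∈ n.divisorsAntidiagonal,
        (((x.1 * y.1 : ℕ) : ℂ)) ^ (-beta3 c' D) * (gstar D (bigT D ^ 2 / ((x.1 * y.1 : ℕ) : ℝ)) : ℂ) *
          (bcoef D (x.2 * y.2) * χ ((x.2 * y.2 : ℕ) : ZMod D)) :=
    fun n hn hc => h32 D χ hD₃₂ hq hp hA n₁ n hn₁ hn₁T hn hc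
  have eϖ : ∀ k : ℕ, 1 ≤ k → Nat.Coprime k (frakq D) → (k : ℝ) < bigP D →
      ‖varpi2loc c' χ j k‖ ≤ 2 * k.divisors.card := fun k hk hc hP => hϖ D χ hD_ϖ hq j k hk hc hP
  have eb : ∀ k : ℕ, ‖bcoef D k‖ ≤ Cb * k.divisors.card := fun k => by
    have := Skeleton.norm_bcoef_le (D := D) hℓ2 k
    rwa [MeanSquareMajorant.tau_two_apply] at this
  -- notation (opaque abbreviations with defining equations)
  set K : ℕ := frakq D with hK
  set RL := (Finset.Ico 1 ⌈2 * bigT D ^ 2⌉₊).filter (fun l => Nat.Coprime l K) with hRL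
  set RM := (Finset.Ico 1 ⌈bigP D⌉₊).filter (fun m => Nat.Coprime m K) with hRM
  obtain ⟨W, hW⟩ : ∃ W : ℕ × ℕ → ℕ → ℂ, ∀ x l, W x l =
      (((x.1 * l : ℕ) : ℂ)) ^ (-beta3 c' D) * (gstar D (bigT D ^ 2 / ((x.1 * l : ℕ) : ℝ)) : ℂ) :=
    ⟨fun x l => _, fun _ _ => rfl⟩
  obtain ⟨B, hB⟩ : ∃ B : ℕ × ℕ → ℕ → ℂ, ∀ x m, B x m =
      bcoef D (x.2 * m) * χ ((x.2 * m : ℕ) : ZMod D) := ⟨fun x m => _, fun _ _ => rfl⟩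
  obtain ⟨Lx, hLx⟩ : ∃ Lx : ℕ × ℕ → ℂ, ∀ x, Lx x =
      ∑ l ∈ RL, W x l * varpi2loc c' χ j l / (l : ℂ) := ⟨fun x => _, fun _ => rfl⟩
  obtain ⟨Mx, hMx⟩ : ∃ Mx : ℕ × ℕ → ℂ, ∀ x, Mx x =
      ∑ m ∈ RM, B x m * varpi2loc c' χ j m / (m : ℂ) := ⟨fun x => _, fun _ => rfl⟩
  obtain ⟨Ex, hEx⟩ : ∃ Ex : ℕ × ℕ → ℂ, ∀ x, Ex x = ∑ l ∈ RL, ∑ m ∈ RM, W x l * B x m *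
      ((varpi2loc c' χ j (l * m) - varpi2loc c' χ j l * varpi2loc c' χ j m) / (((l * m : ℕ) : ℂ))) :=
    ⟨fun x => _, fun _ => rfl⟩
  -- Step 1: exact re-indexing and split
  have hRL0 : ∀ l ∈ RL, l ≠ 0 := fun l hl => by
    rw [hRL, Finset.mem_filter, Finset.mem_Ico] at hl; omega
  have hRM0 : ∀ m ∈ RM, m ≠ 0 := fun m hm => by
    rw [hRM, Finset.mem_filter, Finset.mem_Ico] at hm; omega
  have step1 : ∑ n ∈ (Finset.Ico 1 ⌈bigP D⌉₊).filter (fun n => Nat.Coprime n (frakq D)),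
        b1coef c' χ (n₁ * n) * varpi2loc c' χ j n / (n : ℂ) =
      ∑ x ∈ n₁.divisorsAntidiagonal, (Lx x * Mx x + Ex x) := by
    rw [u033_reindex c' χ hℓ10 j hn₁0 e32]
    refine Finset.sum_congr rfl fun x _ => ?_
    have h := u033_split c' χ j (W x) (B x) RL RM hRL0 hRM0
    rw [hLx x, hMx x, hEx x, ← h]
    refine Finset.sum_congr rfl fun l _ => Finset.sum_congr rfl fun m _ => ?_
    rw [hW, hB]
  -- the main term over the divisor pairs
  have hmainsum : ∑ m₁ ∈ n₁.divisors, χ (m₁ : ZMod D) * (m₁.divisors.card : ℂ) =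
      ∑ x ∈ n₁.divisorsAntidiagonal, χ (x.2 : ZMod D) * (x.2.divisors.card : ℂ) :=
    (Nat.sum_divisorsAntidiagonal' (fun _ m => χ (m : ZMod D) * (m.divisors.card : ℂ))).symm
  have hτ3 : tau3R n₁ = ∑ x ∈ n₁.divisorsAntidiagonal, (x.2.divisors.card : ℝ) := by
    rw [tau3R]; exact (Nat.sum_divisorsAntidiagonal' (fun _ m => (m.divisors.card : ℝ))).symm
  -- Step 2: per outer pair
  have hℓ7i0 : 0 ≤ (ell D ^ 7)⁻¹ := by positivity
  have hαℓ : alpha D * ell D ≤ (ell D ^ 7)⁻¹ := by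
    have hα9 := Skeleton.alpha_mul_ell_pow_nine (D := D) hℓ0
    rw [← one_div, le_div_iff₀ (by positivity)]
    have : alpha D * ell D * ell D ^ 7 = Real.pi / ell D := by
      rw [← hα9]; field_simp
    rw [this, div_le_one hℓ0]
    linarith [Real.pi_lt_d2]
  have hℓ7i : (ell D ^ 7)⁻¹ ≤ 1 := inv_le_one_of_one_le₀ (one_le_pow₀ hℓ1)
  have hEfj : ‖frakeE e1pp j‖ ≤ Ef := by
    simp only [Finset.mem_insert, Finset.mem_singleton] at hj
    rcases hj with rfl | rfl
    · rw [hEf]; linarith [norm_nonneg (frakeE e1pp 2)]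
    · rw [hEf]; linarith [norm_nonneg (frakeE e1pp 1)]
  have hpair : ∀ x ∈ n₁.divisorsAntidiagonal,
      ‖Lx x * Mx x + Ex x - frakeE e1pp j * (χ (x.2 : ZMod D) * (x.2.divisors.card : ℂ))‖ ≤
        (x.2.divisors.card : ℝ) * (Cmain * (ell D ^ 7)⁻¹ + Cb * E₀ * (ell D ^ 44 / (D : ℝ) ^ 4)) := by
    intro x hx
    have hx0 := Nat.mem_divisorsAntidiagonal.mp hx
    have hx1d : x.1 ∈ n₁.divisors := Nat.mem_divisors.mpr ⟨Dvd.intro _ hx0.1, hn₁0⟩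
    have hx2dvd : x.2 ∣ n₁ := Dvd.intro_left _ hx0.1
    have hx1 : 1 ≤ x.1 := Nat.one_le_iff_ne_zero.mpr fun h => hn₁0 (by rw [← hx0.1, h, zero_mul])
    have hx2nset : x.2 ∈ nset (frakq D) := mem_nset_of_dvd' hn₁ hx2dvd
    have hx2T : (x.2 : ℝ) < bigT D :=
      lt_of_le_of_lt (by exact_mod_cast Nat.le_of_dvd hn₁.1 hx2dvd) hn₁T
    -- `τ₂ = τ₂(m₁)` as a real number
    obtain ⟨τ₂, hτ₂⟩ : ∃ t : ℝ, t = (x.2.divisors.card : ℝ) := ⟨_, rfl⟩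
    have hτ₂0 : 0 ≤ τ₂ := by rw [hτ₂]; exact Nat.cast_nonneg _
    have hcastτ : (x.2.divisors.card : ℂ) = (τ₂ : ℂ) := by rw [hτ₂]; push_cast; rfl
    -- (a) innermost sum
    have hLa : ‖Lx x - 1‖ ≤ C_L' * (ell D ^ 7)⁻¹ := by
      have e := eL x.1 hx1d
      have hLeq : Lx x = ∑ l ∈ RL, varpi2loc c' χ j l / ((l : ℂ) * (((x.1 * l : ℕ) : ℂ)) ^ beta3 c' D) *
          (gstar D (bigT D ^ 2 / ((x.1 * l : ℕ) : ℝ)) : ℂ) := by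
        rw [hLx x]
        refine Finset.sum_congr rfl fun l hl => ?_
        rw [hW]
        have hl0 : (l : ℂ) ≠ 0 := by exact_mod_cast hRL0 l hl
        have hb0 : (((x.1 * l : ℕ) : ℂ)) ≠ 0 := by exact_mod_cast Nat.mul_ne_zero (by omega) (hRL0 l hl)
        have hz : (((x.1 * l : ℕ) : ℂ)) ^ beta3 c' D ≠ 0 := by
          rw [Complex.cpow_def_of_ne_zero hb0]; exact Complex.exp_ne_zero _
        rw [Complex.cpow_neg]
        field_simp
      rw [hLeq]
      exact e.trans (mul_le_mul_of_nonneg_right (le_max_left _ _) hℓ7i0)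
    -- (b) the `m`-sum
    have hMb : ‖Mx x - frakeE e1pp j * χ (x.2 : ZMod D) * (τ₂ : ℂ)‖ ≤
        2 * C_M' * (ell D ^ 7)⁻¹ * τ₂ := by
      have e := eM x.2 hx2nset hx2T
      rw [hMx x]
      simp only [hB]
      rw [← hcastτ]
      refine e.trans ?_
      rw [← hτ₂]
      have h0 : 0 ≤ alpha D * ell D + (ell D ^ 7)⁻¹ := by
        have : 0 ≤ alpha D := (Skeleton.alpha_pos_of_ell_pos hℓ0).le
        positivity
      calc C_M * (alpha D * ell D + (ell D ^ 7)⁻¹) * τ₂ ≤ C_M' * (alpha D * ell D + (ell D ^ 7)⁻¹) * τ₂ :=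
            mul_le_mul_of_nonneg_right (mul_le_mul_of_nonneg_right (le_max_left _ _) h0) hτ₂0
        _ ≤ C_M' * (2 * (ell D ^ 7)⁻¹) * τ₂ :=
            mul_le_mul_of_nonneg_right (mul_le_mul_of_nonneg_left (by linarith) hC_M'0) hτ₂0
        _ = 2 * C_M' * (ell D ^ 7)⁻¹ * τ₂ := by ring
    -- (c) the non-coprime correction
    have hEc : ‖Ex x‖ ≤ Cb * τ₂ * E₀ * ell D ^ 44 / (D : ℝ) ^ 4 := by
      have h := u033_noncoprime_le c' χ hℓ j hCb0 eb eϖ hn₁0 hx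
      rw [hEx x]
      refine (norm_sum_le _ _).trans ((Finset.sum_le_sum fun l _ => norm_sum_le _ _).trans ?_)
      rw [hτ₂, hE₀, hKm]
      refine le_trans (le_of_eq ?_) h
      refine Finset.sum_congr rfl fun l _ => Finset.sum_congr rfl fun m _ => ?_
      rw [hW, hB]
    -- (d) combine
    have hMnorm : ‖Mx x‖ ≤ Ef * τ₂ + 2 * C_M' * (ell D ^ 7)⁻¹ * τ₂ := by
      have e : Mx x = (Mx x - frakeE e1pp j * χ (x.2 : ZMod D) * (τ₂ : ℂ)) +
          frakeE e1pp j * χ (x.2 : ZMod D) * (τ₂ : ℂ) := by ring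
      rw [e]
      refine (norm_add_le _ _).trans ?_
      have h2 : ‖frakeE e1pp j * χ (x.2 : ZMod D) * (τ₂ : ℂ)‖ ≤ Ef * τ₂ := by
        rw [norm_mul, norm_mul, Complex.norm_real, Real.norm_of_nonneg hτ₂0]
        exact mul_le_mul_of_nonneg_right
          ((mul_le_mul hEfj (DirichletCharacter.norm_le_one χ _) (norm_nonneg _) hEf0).trans
            (le_of_eq (mul_one Ef))) hτ₂0
      linarith [hMb]
    have hmainx : ‖Lx x * Mx x - frakeE e1pp j * (χ (x.2 : ZMod D) * (τ₂ : ℂ))‖ ≤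
        Cmain * (ell D ^ 7)⁻¹ * τ₂ := by
      have e : Lx x * Mx x - frakeE e1pp j * (χ (x.2 : ZMod D) * (τ₂ : ℂ)) =
          (Lx x - 1) * Mx x + (Mx x - frakeE e1pp j * χ (x.2 : ZMod D) * (τ₂ : ℂ)) := by ring
      rw [e]
      have hkey : (ell D ^ 7)⁻¹ * (ell D ^ 7)⁻¹ ≤ (ell D ^ 7)⁻¹ := by
        calc (ell D ^ 7)⁻¹ * (ell D ^ 7)⁻¹ ≤ (ell D ^ 7)⁻¹ * 1 :=
            mul_le_mul_of_nonneg_left hℓ7i hℓ7i0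
          _ = (ell D ^ 7)⁻¹ := mul_one _
      have hcoef : 0 ≤ 2 * C_L' * C_M' * τ₂ := by positivity
      calc ‖(Lx x - 1) * Mx x + (Mx x - frakeE e1pp j * χ (x.2 : ZMod D) * (τ₂ : ℂ))‖
          ≤ ‖Lx x - 1‖ * ‖Mx x‖ + ‖Mx x - frakeE e1pp j * χ (x.2 : ZMod D) * (τ₂ : ℂ)‖ := by
            rw [← norm_mul]; exact norm_add_le _ _
        _ ≤ (C_L' * (ell D ^ 7)⁻¹) * (Ef * τ₂ + 2 * C_M' * (ell D ^ 7)⁻¹ * τ₂) +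
              2 * C_M' * (ell D ^ 7)⁻¹ * τ₂ :=
            add_le_add (mul_le_mul hLa hMnorm (norm_nonneg _) (mul_nonneg hC_L'0 hℓ7i0)) hMb
        _ = C_L' * Ef * (ell D ^ 7)⁻¹ * τ₂ + 2 * C_M' * (ell D ^ 7)⁻¹ * τ₂ +
              2 * C_L' * C_M' * τ₂ * ((ell D ^ 7)⁻¹ * (ell D ^ 7)⁻¹) := by ring
        _ ≤ C_L' * Ef * (ell D ^ 7)⁻¹ * τ₂ + 2 * C_M' * (ell D ^ 7)⁻¹ * τ₂ +
              2 * C_L' * C_M' * τ₂ * (ell D ^ 7)⁻¹ :=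
            add_le_add_right (mul_le_mul_of_nonneg_left hkey hcoef) _
        _ = Cmain * (ell D ^ 7)⁻¹ * τ₂ := by rw [hCmain]; ring
    have e : Lx x * Mx x + Ex x - frakeE e1pp j * (χ (x.2 : ZMod D) * (x.2.divisors.card : ℂ)) =
        (Lx x * Mx x - frakeE e1pp j * (χ (x.2 : ZMod D) * (τ₂ : ℂ))) + Ex x := by
      rw [hcastτ]; ring
    rw [e, ← hτ₂]
    calc ‖(Lx x * Mx x - frakeE e1pp j * (χ (x.2 : ZMod D) * (τ₂ : ℂ))) + Ex x‖
        ≤ ‖Lx x * Mx x - frakeE e1pp j * (χ (x.2 : ZMod D) * (τ₂ : ℂ))‖ + ‖Ex x‖ := norm_add_le _ _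
      _ ≤ Cmain * (ell D ^ 7)⁻¹ * τ₂ + Cb * τ₂ * E₀ * ell D ^ 44 / (D : ℝ) ^ 4 := add_le_add hmainx hEc
      _ = τ₂ * (Cmain * (ell D ^ 7)⁻¹ + Cb * E₀ * (ell D ^ 44 / (D : ℝ) ^ 4)) := by ring
  -- Step 3: sum over the divisor pairs
  have hpow : ell D ^ 44 / (D : ℝ) ^ 4 ≤ (ell D ^ 7)⁻¹ := by
    have h51 := ell_pow_51_le hD1 hℓ52
    rw [div_le_iff₀ (by positivity : (0 : ℝ) < (D : ℝ) ^ 4), ← div_eq_inv_mul,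
      le_div_iff₀ (by positivity : (0 : ℝ) < ell D ^ 7)]
    calc ell D ^ 44 * ell D ^ 7 = ell D ^ 51 := by ring
      _ ≤ (D : ℝ) ^ 4 := h51
  have hτ3nn : 0 ≤ tau3R n₁ := Finset.sum_nonneg fun _ _ => Nat.cast_nonneg _
  rw [step1, hmainsum, Finset.mul_sum, ← Finset.sum_sub_distrib]
  calc ‖∑ x ∈ n₁.divisorsAntidiagonal,
          (Lx x * Mx x + Ex x - frakeE e1pp j * (χ (x.2 : ZMod D) * (x.2.divisors.card : ℂ)))‖
      ≤ ∑ x ∈ n₁.divisorsAntidiagonal,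
          ‖Lx x * Mx x + Ex x - frakeE e1pp j * (χ (x.2 : ZMod D) * (x.2.divisors.card : ℂ))‖ :=
        norm_sum_le _ _
    _ ≤ ∑ x ∈ n₁.divisorsAntidiagonal,
          (x.2.divisors.card : ℝ) * (Cmain * (ell D ^ 7)⁻¹ + Cb * E₀ * (ell D ^ 44 / (D : ℝ) ^ 4)) :=
        Finset.sum_le_sum hpair
    _ = tau3R n₁ * (Cmain * (ell D ^ 7)⁻¹ + Cb * E₀ * (ell D ^ 44 / (D : ℝ) ^ 4)) := by
        rw [hτ3, Finset.sum_mul]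
    _ ≤ tau3R n₁ * ((Cmain + Cb * E₀) * (ell D ^ 7)⁻¹) := by
        refine mul_le_mul_of_nonneg_left ?_ hτ3nn
        have := mul_le_mul_of_nonneg_left hpow (mul_nonneg hCb0 hE₀0)
        linarith
    _ ≤ (Cmain + Cb * E₀) * (tau3R n₁ * (ell D ^ 7)⁻¹ + (D : ℝ) ^ (-(1 : ℝ))) := by
        have hD' : 0 ≤ (D : ℝ) ^ (-(1 : ℝ)) := Real.rpow_nonneg hDpos.le _
        have hC0 : 0 ≤ Cmain + Cb * E₀ := by positivity
        nlinarith [mul_nonneg hC0 hD']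

/-- **u037 repaired, local reading — the printed instance `e1pp = e1ppj`**:
`Skeleton.Lemma151ChiR c′ → (R) → Step16_u037RL c′`. [cite: Zhang2022LandauSiegel, §16 p. 94 (u037)] -/
theorem step16_u037RL_of (h151 : Lemma151ChiR c')
    (hR : ∃ C₀ : ℝ, 0 ≤ C₀ ∧ ForAllLarge fun D _ χ => AssumptionA D χ → ∀ j ∈ ({1, 2} : Finset ℕ),
      ∀ q r : ℕ, q.Prime → ¬ q ∣ frakq D → 1 ≤ r → ((q ^ r : ℕ) : ℝ) < bigT D ^ 5 →
        ‖varpi2loc c' χ j (q ^ r)‖ * tau3R (q ^ r) ≤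
          if r = 1 then 3 * ‖nu χ q‖ + C₀ * (alpha D * Real.log q + (q : ℝ)⁻¹)
            else C₀ * (3 / 2 : ℝ) ^ r) :
    Step16_u037RL c' := by
  rw [← step16_u037RLE_e1ppj]
  rw [lemma151ChiR_eq_E] at h151
  exact step16_u037RLE_of c' e1ppj h151 hR

end Literature.NumberTheory.LFunctions.Zhang2022.Typed.Section16B
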